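import Literature.Probability.LatticeModels.DobrushinMetricStates
import Mathlib.Probability.Moments.SubGaussian
import Mathlib.MeasureTheory.Function.FactorsThrough
import HarnessLib

/-!
# Venture YMGap, track ROBUST-BALL — GAUSSIAN CONCENTRATION, step 1: the McDiarmid–Azuma bound for the
# finite-volume kernels of ANY specification, from single-site boundary influences (generic)

HONEST FRAMING. WHAT THIS IS: a venture file (cell `pub-ymgap`, track Y2 ROBUST-BALL, seat ds-3, theorems only), the
generic probabilistic engine of the cell's concentration currency C-CONC. For ANY specification `γ` on a
configuration space `V → S` (`IsSpecification γ`: probability kernels, `𝓕_{Λᶜ}`-measurable, proper, consistent),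
ANY finite volume `Λ₀`, ANY bounded measurable observable `f` and ANY vector `c ≥ 0` of **uniform single-site
boundary influences on `f` inside `Λ₀`** — `|∫ f dγ_{Λ'}(·|ω) − ∫ f dγ_{Λ'}(·|η)| ≤ c y` for every `Λ' ⊆ Λ₀`,
`y ∈ Λ₀ ∖ Λ'` and every two boundary conditions `ω = η` off `y` — we prove

* the sub-Gaussian bound of the moment generating function under EVERY kernel with EVERY boundary condition,
  `∫ e^{t f} dγ_{Λ₀}(·|ω) ≤ exp(t · ∫ f dγ_{Λ₀}(·|ω) + t² Σ_{y ∈ Λ₀} c_y² / 8)` (`integral_exp_mul_kernel_le`);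
* McDiarmid's tail bound `γ_{Λ₀}(f − ∫ f dγ_{Λ₀}(·|ω) ≥ r | ω) ≤ exp(−2 r² / Σ_{y ∈ Λ₀} c_y²)`
  (`measureReal_kernel_ge_le`) and its lower-tail twin;
* for EVERY Gibbs measure `μ` of `γ` (no uniqueness): `μ{f − ∫ f dγ_{Λ₀}(·|·) ≥ r} ≤ exp(−2 r² / Σ c_y²)` — Gaussian
  concentration about the conditional expectation given the outside of `Λ₀` (`measureReal_ge_kernel_integral_le`),
  and, when the kernels are uniformly `ε`-close to `μ` on `f` (the cell's boundary-decay currency),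
  `μ{f − ∫ f dμ ≥ r + ε} ≤ exp(−2 r² / Σ c_y²)` (`measureReal_ge_integral_add_le`), two-sided forms.

The proof is the Azuma/McDiarmid martingale argument written as an explicit induction over the sites of the
volume (`Finset.induction_on`), with NO conditional-expectation machinery: for `Λ = insert y Λ'`, consistency
`γ_Λ = γ_Λ γ_{Λ'}` splits `∫ e^{tf} dγ_Λ(·|ω)` into the inner kernel (induction hypothesis) and the law under
`γ_Λ(·|ω)` of the inner mean `g(σ) = ∫ f dγ_{Λ'}(·|σ)`; by properness and `𝓕_{Λ'ᶜ}`-measurability `g` reads only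
the spin at `y` (`g σ = g(ω^{y ↦ σ_y})` a.s.), so it ranges in an interval of length `c y`, and Hoeffding's lemma
(Mathlib `hasSubgaussianMGF_of_mem_Icc`) gives the factor `e^{t² c_y²/8}`; `∫ g dγ_Λ(·|ω) = ∫ f dγ_Λ(·|ω)` by
consistency again. The companion files supply the influences `c` from Dobrushin's comparison theorem
(`Literature.…DobrushinComparisonBoundary.abs_kernel_sub_le_of_superSolution`) for the members of the Y2 ball.
WHAT THIS IS NOT: a large-deviation principle or a central limit theorem (it is the Gaussian UPPER bound only);
nothing here is specific to gauge theories, and nothing is about the continuum limit or the Clay Millennium problem.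

References: K. Azuma, Tôhoku Math. J. 19 (1967) 357–367; C. McDiarmid, *On the method of bounded differences*,
Surveys in Combinatorics 1989, LMS LNS 141, 148–188, Lemma (1.2); C. Külske, *Concentration inequalities for
functions of Gibbs fields with application to diffraction and random Gibbs measures*, Comm. Math. Phys. 239
(2003) 29–51, Thm. 1 (the Gaussian concentration bound in the Dobrushin uniqueness regime, by this martingale
route); J.-R. Chazottes, P. Collet, C. Külske, F. Redig, PTRF 137 (2007) 201–225; H.-O. Georgii, *Gibbs Measures
and Phase Transitions* (2011), Def. 1.23 (specifications). Mathlib: `ProbabilityTheory.hasSubgaussianMGF_of_mem_Icc`,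
`HasSubgaussianMGF.measure_ge_le`.
-/

noncomputable section

open MeasureTheory ProbabilityTheory Filter Function Real
open scoped ENNReal NNReal Topology

namespace Summit.Ventures.YMGap.RobustBall

namespace SpecConcentration

open Literature.Probability.LatticeModels
open Literature.Probability.LatticeModels.DobrushinMetric (integrable_of_abs_le')

variable {V S : Type*} [MeasurableSpace S] {γ : Specification V S}

/-! ### Facts about specifications: outside-measurability, the empty volume, consistency, measurability -/

/-- **A kernel reads only the outside of its volume**: if `η = η'` off `Λ` then `γ_Λ(·|η) = γ_Λ(·|η')` — the
`𝓕_{Λᶜ}`-measurability axiom (Georgii 2011, Def. 1.23 (ii)) and the Doob–Dynkin factorisation through the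
restriction to `Λᶜ` (Mathlib `Measurable.factorsThrough`). [folklore] -/
theorem apply_eq_of_forall_not_mem (hγ : IsSpecification γ) (Λ : Finset V) {η η' : V → S}
    (h : ∀ x, x ∉ Λ → η x = η' x) : γ Λ η = γ Λ η' := by
  ext A hA
  have hm := hγ.measurable Λ A hA
  have hle : cylinderEvents (X := fun _ : V => S) ((↑Λ : Set V)ᶜ) ≤
      MeasurableSpace.comap (Set.restrict ((↑Λ : Set V)ᶜ)) MeasurableSpace.pi := by
    refine iSup₂_le fun i hi => ?_
    have : (fun σ : V → S => σ i) =
        (fun g : (((↑Λ : Set V)ᶜ : Set V)) → S => g ⟨i, hi⟩) ∘ Set.restrict ((↑Λ : Set V)ᶜ) := rfl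
    rw [this, ← MeasurableSpace.comap_comp]
    exact MeasurableSpace.comap_mono (measurable_pi_apply _).comap_le
  have hfac := (hm.mono hle le_rfl).factorsThrough
  refine hfac (funext fun x => h x.1 fun hx => x.2 (Finset.mem_coe.2 hx))

/-- **The empty volume is deterministic**: `∫ f dγ_∅(·|η) = f η` (properness: `γ_∅(·|η)`-a.e. `σ = η`).
[folklore] -/
theorem integral_empty (hγ : IsSpecification γ) (η : V → S) (f : (V → S) → ℝ) :
    ∫ σ, f σ ∂(γ ∅ η) = f η := by
  haveI := hγ.isProbability ∅ η
  have h : ∀ᵐ σ ∂(γ ∅ η), f σ = f η := by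
    filter_upwards [hγ.proper ∅ η] with σ hσ
    rw [show σ = η from funext fun x => hσ x (Finset.notMem_empty x)]
  rw [integral_congr_ae h, integral_const, smul_eq_mul, probReal_univ, one_mul]

/-- **Consistency for observables**: `∫ (∫ F dγ_Λ(·|σ)) γ_{Λ'}(dσ|η) = ∫ F dγ_{Λ'}(·|η)` for `Λ ⊆ Λ'` and `F`
integrable for `γ_{Λ'}(·|η)` (Georgii 2011, Def. 1.23 (iii); Mathlib `Kernel.integral_comp`). [folklore] -/
theorem integral_integral_of_subset (hγ : IsSpecification γ) {Λ Λ' : Finset V} (hsub : Λ ⊆ Λ')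
    (η : V → S) {F : (V → S) → ℝ} (hF : Integrable F (γ Λ' η)) :
    ∫ σ, (∫ τ, F τ ∂(γ Λ σ)) ∂(γ Λ' η) = ∫ τ, F τ ∂(γ Λ' η) := by
  let κ : Kernel (V → S) (V → S) := ⟨γ Λ, hγ.measurable_fun Λ⟩
  have hbind : (γ Λ' η).bind (γ Λ) = γ Λ' η := Measure.ext fun A hA => by
    rw [Measure.bind_apply hA (hγ.measurable_fun Λ).aemeasurable]
    exact hγ.consistent hsub η A hA
  have hcomp : (κ ∘ₖ Kernel.const Unit (γ Λ' η)) () = γ Λ' η := by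
    rw [Kernel.comp_apply, Kernel.const_apply]
    exact hbind
  have hfi : Integrable F ((κ ∘ₖ Kernel.const Unit (γ Λ' η)) ()) := by rwa [hcomp]
  have key := Kernel.integral_comp hfi
  rw [hcomp, Kernel.const_apply] at key
  exact key.symm

/-- The kernel average `σ ↦ ∫ f dγ_Λ(·|σ)` of a measurable real observable is measurable (Mathlib
`StronglyMeasurable.integral_kernel` for the kernel `γ_Λ` on the product σ-algebra). [folklore] -/
theorem measurable_integral (hγ : IsSpecification γ) (Λ : Finset V) {f : (V → S) → ℝ}
    (hf : Measurable f) : Measurable fun σ => ∫ τ, f τ ∂(γ Λ σ) := by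
  let κ : Kernel (V → S) (V → S) := ⟨γ Λ, hγ.measurable_fun Λ⟩
  have h := hf.stronglyMeasurable.integral_kernel (κ := κ)
  exact h.measurable

/-! ### Hoeffding's lemma in the form used by the induction -/

/-- **Hoeffding's lemma, interval form**: under a probability measure, a real random variable a.s. in an interval
of length `c ≥ 0` satisfies `∫ e^{tX} ≤ exp(t ∫ X + t² c² / 8)` (Mathlib `hasSubgaussianMGF_of_mem_Icc`).
[folklore] -/
theorem integral_exp_mul_le_of_mem_Icc {Ω : Type*} [MeasurableSpace Ω] {ν : Measure Ω}
    [IsProbabilityMeasure ν] {X : Ω → ℝ} (hX : AEMeasurable X ν) {a c : ℝ} (hc : 0 ≤ c)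
    (h : ∀ᵐ ω ∂ν, X ω ∈ Set.Icc a (a + c)) (t : ℝ) :
    ∫ ω, exp (t * X ω) ∂ν ≤ exp (t * (∫ ω, X ω ∂ν) + t ^ 2 * c ^ 2 / 8) := by
  have hsg := hasSubgaussianMGF_of_mem_Icc hX h
  have hmgf := hsg.mgf_le t
  simp only [mgf] at hmgf
  have hs : ((((‖a + c - a‖₊ / 2) ^ 2 : ℝ≥0)) : ℝ) = c ^ 2 / 4 := by
    rw [NNReal.coe_pow, NNReal.coe_div, coe_nnnorm, add_sub_cancel_left, Real.norm_eq_abs, abs_of_nonneg hc]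
    norm_num
    ring
  rw [hs] at hmgf
  have e : ∀ ω, exp (t * X ω) = exp (t * ∫ ω, X ω ∂ν) * exp (t * (X ω - ∫ ω, X ω ∂ν)) := fun ω => by
    rw [← exp_add]
    ring_nf
  calc ∫ ω, exp (t * X ω) ∂ν = exp (t * ∫ ω, X ω ∂ν) * ∫ ω, exp (t * (X ω - ∫ ω, X ω ∂ν)) ∂ν := by
        simp_rw [e]
        exact integral_const_mul _ _
    _ ≤ exp (t * ∫ ω, X ω ∂ν) * exp (c ^ 2 / 4 * t ^ 2 / 2) :=
        mul_le_mul_of_nonneg_left hmgf (exp_pos _).le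
    _ = exp (t * (∫ ω, X ω ∂ν) + t ^ 2 * c ^ 2 / 8) := by
        rw [← exp_add]
        ring_nf

/-! ### The McDiarmid–Azuma bound for the kernels of a specification -/

/-- **Sub-Gaussian moment generating function of every finite-volume kernel from single-site boundary
influences** (Azuma 1967 / McDiarmid 1989, Lemma (1.2), for the martingale of successive conditionings of a
Gibbs kernel; Külske 2003, proof of Thm. 1). Let `γ` be a specification, `Λ₀` a finite volume, `f` bounded
measurable, and `c ≥ 0` with `|∫ f dγ_{Λ'}(·|ω) − ∫ f dγ_{Λ'}(·|η)| ≤ c y` whenever `Λ' ⊆ Λ₀`, `y ∈ Λ₀ ∖ Λ'` and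
`ω = η` off `y`. Then for every `t` and every boundary condition `ω`:
`∫ e^{t f} dγ_{Λ₀}(·|ω) ≤ exp(t ∫ f dγ_{Λ₀}(·|ω) + t² (Σ_{y ∈ Λ₀} c_y²) / 8)`. Induction on `Λ ⊆ Λ₀`:
consistency, properness (the inner mean reads one spin), Hoeffding's lemma. [folklore] -/
theorem integral_exp_mul_kernel_le (hγ : IsSpecification γ) (Λ₀ : Finset V) {f : (V → S) → ℝ}
    (hfm : Measurable f) {M : ℝ} (hM : ∀ σ, |f σ| ≤ M) {c : V → ℝ} (hc0 : ∀ y, 0 ≤ c y)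
    (hc : ∀ Λ', Λ' ⊆ Λ₀ → ∀ y ∈ Λ₀, y ∉ Λ' → ∀ ω η : V → S, (∀ z, z ≠ y → ω z = η z) →
      |(∫ σ, f σ ∂(γ Λ' ω)) - ∫ σ, f σ ∂(γ Λ' η)| ≤ c y)
    (t : ℝ) (ω : V → S) :
    ∫ σ, exp (t * f σ) ∂(γ Λ₀ ω) ≤
      exp (t * (∫ σ, f σ ∂(γ Λ₀ ω)) + t ^ 2 * (∑ y ∈ Λ₀, c y ^ 2) / 8) := by
  classical
  suffices H : ∀ Λ : Finset V, Λ ⊆ Λ₀ → ∀ ω : V → S,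
      ∫ σ, exp (t * f σ) ∂(γ Λ ω) ≤ exp (t * (∫ σ, f σ ∂(γ Λ ω)) + t ^ 2 * (∑ y ∈ Λ, c y ^ 2) / 8) from
    H Λ₀ subset_rfl ω
  intro Λ
  induction Λ using Finset.induction_on with
  | empty =>
    intro _ ω
    rw [integral_empty hγ, integral_empty hγ, Finset.sum_empty, mul_zero, zero_div, add_zero]
  | insert y Λ hy ih =>
    intro hsub ω
    have hΛsub : Λ ⊆ Λ₀ := (Finset.subset_insert y Λ).trans hsub
    have hyΛ₀ : y ∈ Λ₀ := hsub (Finset.mem_insert_self y Λ)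
    haveI : IsProbabilityMeasure (γ (insert y Λ) ω) := hγ.isProbability _ ω
    -- the inner mean
    set g : (V → S) → ℝ := fun σ => ∫ τ, f τ ∂(γ Λ σ) with hg
    have hgm : Measurable g := measurable_integral hγ Λ hfm
    have hgM : ∀ σ, |g σ| ≤ M := fun σ => by
      -- (the tree's `IsSpecification.abs_integral_le` of `GibbsExistenceCompact.lean`, inlined)
      haveI := hγ.isProbability Λ σ
      have h := norm_integral_le_of_norm_le_const (μ := γ Λ σ) (f := f) (C := M)
        (ae_of_all _ fun τ => by rw [Real.norm_eq_abs]; exact hM τ)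
      simpa using h
    -- the exponential observable and its bound
    have hexpm : Measurable fun σ => exp (t * f σ) := measurable_exp.comp (measurable_const.mul hfm)
    have hexpB : ∀ σ, |exp (t * f σ)| ≤ exp (|t| * M) := fun σ => by
      rw [abs_of_pos (exp_pos _), exp_le_exp]
      calc t * f σ ≤ |t * f σ| := le_abs_self _
        _ = |t| * |f σ| := abs_mul _ _
        _ ≤ |t| * M := mul_le_mul_of_nonneg_left (hM σ) (abs_nonneg _)
    -- step 1: consistency for `e^{tf}`
    have h1 : ∫ σ, exp (t * f σ) ∂(γ (insert y Λ) ω) =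
        ∫ σ, (∫ τ, exp (t * f τ) ∂(γ Λ σ)) ∂(γ (insert y Λ) ω) :=
      (integral_integral_of_subset hγ (Finset.subset_insert y Λ) ω (integrable_of_abs_le' hexpm hexpB)).symm
    -- step 2: the induction hypothesis inside
    set S₀ : ℝ := t ^ 2 * (∑ z ∈ Λ, c z ^ 2) / 8 with hS₀
    have hbm : Measurable fun σ => exp (t * g σ + S₀) :=
      measurable_exp.comp ((measurable_const.mul hgm).add measurable_const)
    have hbB : ∀ σ, |exp (t * g σ + S₀)| ≤ exp (|t| * M + S₀) := fun σ => by
      rw [abs_of_pos (exp_pos _), exp_le_exp]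
      have : t * g σ ≤ |t| * M :=
        calc t * g σ ≤ |t * g σ| := le_abs_self _
          _ = |t| * |g σ| := abs_mul _ _
          _ ≤ |t| * M := mul_le_mul_of_nonneg_left (hgM σ) (abs_nonneg _)
      linarith
    have h2 : ∫ σ, (∫ τ, exp (t * f τ) ∂(γ Λ σ)) ∂(γ (insert y Λ) ω) ≤
        ∫ σ, exp (t * g σ + S₀) ∂(γ (insert y Λ) ω) := by
      refine integral_mono_of_nonneg (ae_of_all _ fun σ => integral_nonneg fun τ => (exp_pos _).le)
        (integrable_of_abs_le' hbm hbB) (ae_of_all _ fun σ => ?_)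
      have := ih hΛsub σ
      simpa only [hg, hS₀] using this
    -- step 3: pull out the constant
    have h3 : ∫ σ, exp (t * g σ + S₀) ∂(γ (insert y Λ) ω) =
        exp S₀ * ∫ σ, exp (t * g σ) ∂(γ (insert y Λ) ω) := by
      rw [← integral_const_mul]
      refine integral_congr_ae (ae_of_all _ fun σ => ?_)
      show exp (t * g σ + S₀) = exp S₀ * exp (t * g σ)
      rw [exp_add, mul_comm]
    -- step 4: Hoeffding for `g` under `γ_{insert y Λ}(·|ω)`: `g` reads only the spin at `y`
    have hosc : ∀ u u' : S, |g (update ω y u) - g (update ω y u')| ≤ c y := fun u u' =>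
      hc Λ hΛsub y hyΛ₀ hy _ _ fun z hz => by rw [update_of_ne hz, update_of_ne hz]
    have hbdd : BddBelow (Set.range fun u : S => g (update ω y u)) :=
      ⟨-M, by rintro _ ⟨u, rfl⟩; exact (abs_le.1 (hgM _)).1⟩
    set a : ℝ := sInf (Set.range fun u : S => g (update ω y u)) with ha
    have hIcc : ∀ u : S, g (update ω y u) ∈ Set.Icc a (a + c y) := fun u => by
      refine ⟨csInf_le hbdd ⟨u, rfl⟩, ?_⟩
      have h' : g (update ω y u) - c y ≤ a :=
        le_csInf ⟨_, ⟨u, rfl⟩⟩ (by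
          rintro _ ⟨u', rfl⟩
          have := hosc u u'
          linarith [(abs_le.1 this).2])
      linarith
    have hae : ∀ᵐ σ ∂(γ (insert y Λ) ω), g σ = g (update ω y (σ y)) := by
      filter_upwards [hγ.proper (insert y Λ) ω] with σ hσ
      simp only [hg]
      rw [apply_eq_of_forall_not_mem hγ Λ (η := σ) (η' := update ω y (σ y))]
      intro x hx
      by_cases hxy : x = y
      · subst hxy; simp
      · rw [update_of_ne hxy]
        exact hσ x fun h => (Finset.mem_insert.1 h).elim hxy hx
    have hae' : ∀ᵐ σ ∂(γ (insert y Λ) ω), g σ ∈ Set.Icc a (a + c y) := by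
      filter_upwards [hae] with σ hσ
      rw [hσ]
      exact hIcc _
    have h4 : ∫ σ, exp (t * g σ) ∂(γ (insert y Λ) ω) ≤
        exp (t * (∫ σ, g σ ∂(γ (insert y Λ) ω)) + t ^ 2 * c y ^ 2 / 8) :=
      integral_exp_mul_le_of_mem_Icc hgm.aemeasurable (hc0 y) hae' t
    -- step 5: `∫ g = ∫ f` by consistency
    have h5 : ∫ σ, g σ ∂(γ (insert y Λ) ω) = ∫ σ, f σ ∂(γ (insert y Λ) ω) :=
      integral_integral_of_subset hγ (Finset.subset_insert y Λ) ω (integrable_of_abs_le' hfm hM)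
    -- assemble
    rw [Finset.sum_insert hy]
    calc ∫ σ, exp (t * f σ) ∂(γ (insert y Λ) ω)
        = ∫ σ, (∫ τ, exp (t * f τ) ∂(γ Λ σ)) ∂(γ (insert y Λ) ω) := h1
      _ ≤ ∫ σ, exp (t * g σ + S₀) ∂(γ (insert y Λ) ω) := h2
      _ = exp S₀ * ∫ σ, exp (t * g σ) ∂(γ (insert y Λ) ω) := h3
      _ ≤ exp S₀ * exp (t * (∫ σ, g σ ∂(γ (insert y Λ) ω)) + t ^ 2 * c y ^ 2 / 8) :=
          mul_le_mul_of_nonneg_left h4 (exp_pos _).le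
      _ = exp (t * (∫ σ, f σ ∂(γ (insert y Λ) ω)) + t ^ 2 * (c y ^ 2 + ∑ z ∈ Λ, c z ^ 2) / 8) := by
          rw [← exp_add, h5, hS₀]
          ring_nf

/-- **The centred observable is sub-Gaussian under every kernel** with variance proxy `Σ_{y ∈ Λ₀} c_y² / 4`
(Mathlib's normalisation `mgf ≤ exp(c t²/2)`, the proxy as `Real.toNNReal`). [folklore] -/
theorem hasSubgaussianMGF_kernel (hγ : IsSpecification γ) (Λ₀ : Finset V) {f : (V → S) → ℝ}
    (hfm : Measurable f) {M : ℝ} (hM : ∀ σ, |f σ| ≤ M) {c : V → ℝ} (hc0 : ∀ y, 0 ≤ c y)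
    (hc : ∀ Λ', Λ' ⊆ Λ₀ → ∀ y ∈ Λ₀, y ∉ Λ' → ∀ ω η : V → S, (∀ z, z ≠ y → ω z = η z) →
      |(∫ σ, f σ ∂(γ Λ' ω)) - ∫ σ, f σ ∂(γ Λ' η)| ≤ c y)
    (ω : V → S) :
    HasSubgaussianMGF (fun σ => f σ - ∫ τ, f τ ∂(γ Λ₀ ω))
      ((∑ y ∈ Λ₀, c y ^ 2) / 4).toNNReal (γ Λ₀ ω) := by
  haveI : IsProbabilityMeasure (γ Λ₀ ω) := hγ.isProbability _ ω
  set m : ℝ := ∫ τ, f τ ∂(γ Λ₀ ω) with hm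
  have hcm : ∀ t : ℝ, Measurable fun σ => exp (t * (f σ - m)) := fun t =>
    measurable_exp.comp (measurable_const.mul (hfm.sub measurable_const))
  have hcB : ∀ t : ℝ, ∀ σ, |exp (t * (f σ - m))| ≤ exp (|t| * (M + |m|)) := fun t σ => by
    rw [abs_of_pos (exp_pos _), exp_le_exp]
    calc t * (f σ - m) ≤ |t * (f σ - m)| := le_abs_self _
      _ = |t| * |f σ - m| := abs_mul _ _
      _ ≤ |t| * (M + |m|) := mul_le_mul_of_nonneg_left
          ((abs_sub _ _).trans (add_le_add (hM σ) le_rfl)) (abs_nonneg _)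
  refine ⟨fun t => integrable_of_abs_le' (hcm t) (hcB t), fun t => ?_⟩
  simp only [mgf]
  rw [Real.coe_toNNReal _ (by positivity)]
  have key := integral_exp_mul_kernel_le hγ Λ₀ hfm hM hc0 hc t ω
  have e : ∀ σ, exp (t * (f σ - m)) = exp (-(t * m)) * exp (t * f σ) := fun σ => by
    rw [← exp_add]; ring_nf
  calc ∫ σ, exp (t * (f σ - m)) ∂(γ Λ₀ ω) = exp (-(t * m)) * ∫ σ, exp (t * f σ) ∂(γ Λ₀ ω) := by
        simp_rw [e]; exact integral_const_mul _ _
    _ ≤ exp (-(t * m)) * exp (t * m + t ^ 2 * (∑ y ∈ Λ₀, c y ^ 2) / 8) :=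
        mul_le_mul_of_nonneg_left key (exp_pos _).le
    _ = exp ((∑ y ∈ Λ₀, c y ^ 2) / 4 * t ^ 2 / 2) := by
        rw [← exp_add]; ring_nf

/-- **McDiarmid's inequality for the kernels of a specification** (McDiarmid 1989, Lemma (1.2); Külske 2003,
Thm. 1, finite-volume form): under the hypotheses of `integral_exp_mul_kernel_le`, for every `r ≥ 0` and every
boundary condition `ω`, `γ_{Λ₀}({f − ∫ f dγ_{Λ₀}(·|ω) ≥ r} | ω) ≤ exp(−2 r² / Σ_{y ∈ Λ₀} c_y²)`. [folklore] -/
theorem measureReal_kernel_ge_le (hγ : IsSpecification γ) (Λ₀ : Finset V) {f : (V → S) → ℝ}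
    (hfm : Measurable f) {M : ℝ} (hM : ∀ σ, |f σ| ≤ M) {c : V → ℝ} (hc0 : ∀ y, 0 ≤ c y)
    (hc : ∀ Λ', Λ' ⊆ Λ₀ → ∀ y ∈ Λ₀, y ∉ Λ' → ∀ ω η : V → S, (∀ z, z ≠ y → ω z = η z) →
      |(∫ σ, f σ ∂(γ Λ' ω)) - ∫ σ, f σ ∂(γ Λ' η)| ≤ c y)
    {r : ℝ} (hr : 0 ≤ r) (ω : V → S) :
    (γ Λ₀ ω).real {σ | r ≤ f σ - ∫ τ, f τ ∂(γ Λ₀ ω)} ≤ exp (-2 * r ^ 2 / ∑ y ∈ Λ₀, c y ^ 2) := by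
  haveI : IsProbabilityMeasure (γ Λ₀ ω) := hγ.isProbability _ ω
  have h := (hasSubgaussianMGF_kernel hγ Λ₀ hfm hM hc0 hc ω).measure_ge_le hr
  rw [Real.coe_toNNReal _ (by positivity)] at h
  refine h.trans (le_of_eq ?_)
  congr 1
  ring

/-- **Lower tail**: `γ_{Λ₀}({∫ f dγ_{Λ₀}(·|ω) − f ≥ r} | ω) ≤ exp(−2 r² / Σ c_y²)` (the bound for `−f`, whose
influences are the same). [folklore] -/
theorem measureReal_kernel_le_le (hγ : IsSpecification γ) (Λ₀ : Finset V) {f : (V → S) → ℝ}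
    (hfm : Measurable f) {M : ℝ} (hM : ∀ σ, |f σ| ≤ M) {c : V → ℝ} (hc0 : ∀ y, 0 ≤ c y)
    (hc : ∀ Λ', Λ' ⊆ Λ₀ → ∀ y ∈ Λ₀, y ∉ Λ' → ∀ ω η : V → S, (∀ z, z ≠ y → ω z = η z) →
      |(∫ σ, f σ ∂(γ Λ' ω)) - ∫ σ, f σ ∂(γ Λ' η)| ≤ c y)
    {r : ℝ} (hr : 0 ≤ r) (ω : V → S) :
    (γ Λ₀ ω).real {σ | r ≤ (∫ τ, f τ ∂(γ Λ₀ ω)) - f σ} ≤ exp (-2 * r ^ 2 / ∑ y ∈ Λ₀, c y ^ 2) := by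
  have hc' : ∀ Λ', Λ' ⊆ Λ₀ → ∀ y ∈ Λ₀, y ∉ Λ' → ∀ ω η : V → S, (∀ z, z ≠ y → ω z = η z) →
      |(∫ σ, (-f σ) ∂(γ Λ' ω)) - ∫ σ, (-f σ) ∂(γ Λ' η)| ≤ c y := by
    intro Λ' hΛ' y hy hy' ω η hωη
    rw [integral_neg, integral_neg, ← abs_neg]
    convert hc Λ' hΛ' y hy hy' ω η hωη using 2
    ring
  have h := measureReal_kernel_ge_le hγ Λ₀ hfm.neg (fun σ => by rw [Pi.neg_apply, abs_neg]; exact hM σ)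
    hc0 hc' hr ω
  refine le_trans (le_of_eq ?_) h
  congr 1
  ext σ
  simp only [Set.mem_setOf_eq, Pi.neg_apply, integral_neg]
  constructor <;> intro h' <;> linarith

end SpecConcentration

end Summit.Ventures.YMGap.RobustBall

end
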